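import Literature.AlgebraicGeometry.Modules.ProjectiveDimensionFiniteOfRegular
import Literature.AlgebraicGeometry.Modules.IdealSheafNoetherian
import HarnessLib

/-!
# Syzygy sheaves on a noetherian regular scheme are eventually locally free — with NO dimension bound
# (Hartshorne III Ex. 6.9 (a); Fulton B.8.3 (ii); Görtz–Wedhorn II, Prop. 23.55 / G.5)

Layer `Literature/AlgebraicGeometry/Modules` (0 named facts, no definitions, no instances, no notation).
Sequel to `Modules/SyzygyLocallyFreeOfRegular`, whose frontier-kernel theorem
`isFiniteLocallyFree_kernel_of_isRegular` assumes that the stalks of the regular scheme `X` have Krull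
dimension `≤ d` — a hypothesis a noetherian regular scheme need not satisfy (Nagata's noetherian regular rings
of infinite Krull dimension), and which Hartshorne III Ex. 6.9 (a) ("`X` noetherian, integral, separated,
regular") does not make. Here the dimension bound is replaced by what the syzygy argument actually uses, a
bound on the PROJECTIVE DIMENSION of the sections of the coherent sheaf `F` being resolved, and that bound is
then PRODUCED on every noetherian regular scheme from `Modules/ProjectiveDimensionFiniteOfRegular`
(over a regular ring every finite module has finite projective dimension):

* §1 `finite_projective_sections_kernel_of_hasProjectiveDimensionLE` — for `V` affine with
  `pd_{Γ(V, 𝒪_X)} Γ(V, F) ≤ d`, a complex `Q` of finite locally free modules with `Q¹ = 0` and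
  `β : Q ⟶ F[0]` a quasi-isomorphism in degrees `> f`, `f < 0`, `f + d ≤ 1`: `Γ(V, ker(Qᶠ → Qᶠ⁺¹))` is a
  finite projective `Γ(V, 𝒪_X)`-module (the proof of `finite_projective_sections_kernel_of_stalk`, verbatim,
  with its Auslander–Buchsbaum–Serre step replaced by the hypothesis); `isFiniteLocallyFree_kernel_of_forall_pd`
  — hence `ker(Qᶠ → Qᶠ⁺¹)` is finite locally free as soon as every point has such an affine neighbourhood;
* §2 `isRegularLocalRing_localization_of_isRegular` (the localizations of `Γ(V, 𝒪_X)`, `V` affine, at primes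
  are the stalks, hence regular), **`exists_forall_hasProjectiveDimensionLE_sections`** — on a NOETHERIAN
  regular scheme, for `F` coherent there is ONE `d` such that every point has an affine neighbourhood `V`
  with `pd_{Γ(V)} Γ(V, F) ≤ d` (finite affine cover + `exists_hasProjectiveDimensionLE_of_isRegularLocalRing_localization`);
* §3 **`exists_isFiniteLocallyFree_kernel_of_isRegular`** — on a noetherian regular scheme, for `F` coherent
  there is `d` such that for every `Q`, `β`, `f` as above with `f + d ≤ 1` the frontier kernel
  `ker(Qᶠ → Qᶠ⁺¹)` is finite locally free.

The assembly into a strictly perfect resolution (with the resolution property as input) is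
`Modules/StrictlyPerfectResolutionOfRegularNoetherian`. Everything is proved; `Modules/SyzygyLocallyFreeOfRegular`
is unchanged.

## References

* R. Hartshorne, *Algebraic Geometry*, GTM 52 (1977): II Prop. 5.6, III Ex. 6.5, Ex. 6.9 (a) (p. 238).
  [Hartshorne1977]
* W. Fulton, *Intersection Theory*, 2nd ed. (1998), App. B.8.3 (ii). [Fulton1998]
* U. Görtz, T. Wedhorn, *Algebraic Geometry II* (2023), Prop. 23.55, Prop. G.5. [GortzWedhorn2023]
* H. Matsumura, *Commutative Ring Theory* (1986), Thm. 19.2. [Matsumura1987]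
-/

noncomputable section

universe u

open CategoryTheory CategoryTheory.Limits AlgebraicGeometry TopologicalSpace Opposite

namespace Literature.AlgebraicGeometry.Modules

open Literature.AlgebraicGeometry.Morphisms Literature.AlgebraicGeometry.Motives
  Literature.AlgebraicGeometry.KTheory Literature.AlgebraicGeometry.KTheory.Adapted
  Literature.Algebra.Homology.AttachCell Literature.AlgebraicGeometry.Resolution HomologicalComplex

variable {X : Scheme.{u}}

/-! ### §1 The frontier kernel under a projective-dimension bound on the sections of `F` -/

section PD

variable [IsLocallyNoetherian X]

/-- **Sections of the frontier kernel over an affine open are finite projective, under `pd Γ(V, F) ≤ d`.**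
Let `V` be an affine open of the locally noetherian scheme `X` with `pd_{Γ(V, 𝒪_X)} Γ(V, F) ≤ d` for the
coherent `F`; let `Q` be a cochain complex of finite locally free `𝒪_X`-modules with `Q¹ = 0` and
`β : Q ⟶ F[0]` a quasi-isomorphism in every degree `> f`, where `f < 0` and `f + d ≤ 1`. Then
`Γ(V, ker(Qᶠ → Qᶠ⁺¹))` is a finite projective `Γ(V, 𝒪_X)`-module (a `(1 - f)`-th syzygy of `Γ(V, F)` on the
exact complex of sections over the affine `V`, Hartshorne II Prop. 5.6). The proof is that of
`finite_projective_sections_kernel_of_stalk`, with the projective-dimension bound a hypothesis.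
[cite: Hartshorne1977, III Ex. 6.5 and Ex. 6.9 (a) (p. 238)] [cite: Fulton1998, App. B.8.3 (ii)] -/
theorem finite_projective_sections_kernel_of_hasProjectiveDimensionLE {d : ℕ} {V : X.Opens}
    (hV : IsAffineOpen V) (Q : CochainComplex X.Modules ℤ) (hQ : ∀ i, IsFiniteLocallyFree (Q.X i))
    (h1 : IsZero (Q.X 1)) {F : X.Modules} (hF : Coh F)
    (hN : HasProjectiveDimensionLE (ModuleCat.of Γ(X, V) Γ(F, V)) d)
    (β : Q ⟶ (single X.Modules (ComplexShape.up ℤ) 0).obj F)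
    {f : ℤ} (hβ : ∀ i, f < i → QuasiIsoAt β i) (hf0 : f < 0) (hfd : f + d ≤ 1) :
    Module.Finite Γ(X, V) Γ(kernel (Q.d f (f + 1)), V) ∧
      Module.Projective Γ(X, V) Γ(kernel (Q.d f (f + 1)), V) := by
  haveI : IsNoetherianRing Γ(X, V) := IsLocallyNoetherian.component_noetherian ⟨V, hV⟩
  have hPF : ∀ i, Module.Finite Γ(X, V) Γ(Q.X i, V) ∧ Module.Projective Γ(X, V) Γ(Q.X i, V) :=
    fun i => finite_projective_sections_of_isFiniteLocallyFree (hQ i) hV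
  have hcoh : ∀ i, Coh (Q.X i) := fun i => coh_of_isFiniteLocallyFree (hQ i)
  -- the augmentation `π : Q⁰ → F` and exactness in degree `0`
  let π : Q.X 0 ⟶ F := β.f 0 ≫ (singleObjXSelf (ComplexShape.up ℤ) 0 F).hom
  have h1' : IsZero (Q.X (0 + 1)) := by simpa using h1
  obtain ⟨hex0, hepi⟩ := (quasiIsoAt_toSingle_iff Q 0 h1' F β).mp (hβ 0 (by omega))
  have w0 : Q.d (0 - 1) 0 ≫ π = 0 := by
    simp only [π, ← Category.assoc]
    rw [← β.comm, single_obj_d, comp_zero, zero_comp]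
  -- first syzygy: `ker π_V`
  haveI : Epi π := hepi
  have hsurjπ : Function.Surjective (appLinear π V) := app_surjective_of_epi π (hcoh 0).loc hF.loc hV
  have hK0 : HasProjectiveDimensionLT (ModuleCat.of Γ(X, V) (LinearMap.ker (appLinear π V)))
      (d - 1 + 1) := by
    haveI := (hPF 0).2
    haveI : HasProjectiveDimensionLT (ModuleCat.of Γ(X, V) Γ(F, V)) (d + 1) := hN
    exact hasProjectiveDimensionLT_ker_of_surjective (appLinear π V) hsurjπ
      (hasProjectiveDimensionLT_of_ge _ (d + 1) (d - 1 + 2) (by omega))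
  -- higher syzygies: `ker (dⁱ)_V`, `i = -n-1`
  have iter : ∀ (n : ℕ) (i j : ℤ), i = -(n : ℤ) - 1 → i + 1 = j → f ≤ i →
      HasProjectiveDimensionLT (ModuleCat.of Γ(X, V) (LinearMap.ker (appLinear (Q.d i j) V)))
        (d - (n + 2) + 1) := by
    intro n
    induction n with
    | zero =>
      intro i j hi hij _
      obtain rfl : j = 0 := by omega
      obtain rfl : i = 0 - 1 := by omega
      haveI := (hPF (0 - 1)).2
      haveI := hK0
      refine hasProjectiveDimensionLT_ker_of_range_eq (appLinear (Q.d (0 - 1) 0) V)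
        (LinearMap.ker (appLinear π V)) ?_
        (hasProjectiveDimensionLT_of_ge _ (d - 1 + 1) (d - (0 + 2) + 2) (by omega))
      ext y
      constructor
      · rintro ⟨x, rfl⟩
        exact app_app_eq_zero (ShortComplex.mk (Q.d (0 - 1) 0) π w0) V x
      · intro hy
        obtain ⟨x, hx⟩ := exists_app_eq_of_exact hex0 (hcoh _) (hcoh 0) hV y hy
        exact ⟨x, hx⟩
    | succ n ih =>
      intro i j hi hij hfi
      have hj : j = -(n : ℤ) - 1 := by omega
      have ih' := ih j (j + 1) hj rfl (by omega)
      haveI := (hPF i).2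
      haveI := ih'
      refine hasProjectiveDimensionLT_ker_of_range_eq (appLinear (Q.d i j) V)
        (LinearMap.ker (appLinear (Q.d j (j + 1)) V)) ?_
        (hasProjectiveDimensionLT_of_ge _ (d - (n + 2) + 1) (d - (n + 1 + 2) + 2) (by omega))
      -- exactness of `Q` at `j` (`f < j < 0`) on sections over the affine `V`
      have hexj : Q.ExactAt j :=
        (quasiIsoAt_iff_exactAt' β j (exactAt_single_obj _ _ _ _ (by omega))).mp (hβ j (by omega))
      have hsc : (Q.sc' i j (j + 1)).Exact :=
        (Q.exactAt_iff' i j (j + 1) (by simp only [CochainComplex.prev]; omega)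
          (by simp only [CochainComplex.next])).mp hexj
      ext y
      constructor
      · rintro ⟨x, rfl⟩
        exact app_app_eq_zero (Q.sc' i j (j + 1)) V x
      · intro hy
        obtain ⟨x, hx⟩ := exists_app_eq_of_exact hsc (hcoh i) (hcoh j) hV y hy
        exact ⟨x, hx⟩
  -- the frontier kernel `ker (dᶠ)_V`: `f = -n-1` with `d ≤ n + 2`
  obtain ⟨n, hn⟩ : ∃ n : ℕ, f = -(n : ℤ) - 1 :=
    ⟨(-f - 1).toNat, by have := Int.toNat_of_nonneg (show (0 : ℤ) ≤ -f - 1 by omega); omega⟩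
  have hfin := iter n f (f + 1) hn rfl le_rfl
  have hexp : d - (n + 2) + 1 = 1 := by omega
  rw [hexp] at hfin
  have hproj : Module.Projective Γ(X, V) (LinearMap.ker (appLinear (Q.d f (f + 1)) V)) :=
    projective_of_hasProjectiveDimensionLT_one hfin
  have hfinK : Module.Finite Γ(X, V) (LinearMap.ker (appLinear (Q.d f (f + 1)) V)) := by
    haveI := (hPF f).1
    haveI : IsNoetherian Γ(X, V) Γ(Q.X f, V) := isNoetherian_of_isNoetherianRing_of_finite _ _
    exact Module.Finite.of_injective (LinearMap.ker (appLinear (Q.d f (f + 1)) V)).subtype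
      Subtype.val_injective
  -- transport to the sections of the kernel module
  let e : Γ(kernel (Q.d f (f + 1)), V) ≃ₗ[Γ(X, V)] LinearMap.ker (appLinear (Q.d f (f + 1)) V) :=
    LinearEquiv.ofBijective
      ((appLinear (kernel.ι (Q.d f (f + 1))) V).codRestrict _ fun m => app_kernel_ι_app _ V m)
      ⟨fun a b h => kernel_ι_app_injective (Q.d f (f + 1)) V (congrArg Subtype.val h), fun y => by
        obtain ⟨m, hm⟩ := exists_kernel_ι_app_eq (Q.d f (f + 1)) V y.1 y.2
        exact ⟨m, Subtype.ext hm⟩⟩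
  haveI := hproj
  haveI := hfinK
  exact ⟨Module.Finite.equiv e.symm, Module.Projective.of_equiv e.symm⟩

/-- **The frontier kernel is finite locally free when every point has an affine neighbourhood `V` with
`pd Γ(V, F) ≤ d`** (`f < 0`, `f + d ≤ 1`): finite projective sections over an affine open give frames on basic
opens (`AffineVectorBundleSections.exists_free_over_basicOpen_of_projective_sections`).
[cite: Hartshorne1977, III Ex. 6.9 (a) (p. 238)] [cite: Fulton1998, App. B.8.3 (ii)] -/
theorem isFiniteLocallyFree_kernel_of_forall_pd {d : ℕ} {F : X.Modules} (hF : Coh F)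
    (hd : ∀ x : X, ∃ (V : X.Opens) (_ : IsAffineOpen V), x ∈ V ∧
      HasProjectiveDimensionLE (ModuleCat.of Γ(X, V) Γ(F, V)) d)
    (Q : CochainComplex X.Modules ℤ) (hQ : ∀ i, IsFiniteLocallyFree (Q.X i)) (h1 : IsZero (Q.X 1))
    (β : Q ⟶ (single X.Modules (ComplexShape.up ℤ) 0).obj F)
    {f : ℤ} (hβ : ∀ i, f < i → QuasiIsoAt β i) (hf0 : f < 0) (hfd : f + d ≤ 1) :
    IsFiniteLocallyFree (kernel (Q.d f (f + 1))) := by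
  intro x
  obtain ⟨V, hV, hxV, hN⟩ := hd x
  obtain ⟨hfin, hproj⟩ := finite_projective_sections_kernel_of_hasProjectiveDimensionLE hV Q hQ h1 hF hN β
    hβ hf0 hfd
  haveI := hfin
  haveI := hproj
  have hK : IsAffineLocalizing (kernel (Q.d f (f + 1))) :=
    IsAffineLocalizing.kernel _ (coh_of_isFiniteLocallyFree (hQ f)).loc
      (coh_of_isFiniteLocallyFree (hQ (f + 1))).loc
  obtain ⟨r, hxr, ι, hι, e⟩ := exists_free_over_basicOpen_of_projective_sections hK hV hxV
  exact ⟨X.basicOpen r, hxr, ι, hι, e⟩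

end PD

/-! ### §2 On a noetherian regular scheme: one projective-dimension bound for all points -/

section Regular

/-- On an affine open `V = Spec R` of a scheme whose stalks at the points of `V` are regular local rings,
every localization `R_𝔭` of `R = Γ(X, V)` at a prime is a regular local ring (`R_𝔭 ≅ 𝒪_{X,x}` for the point
`x ∈ V` of `𝔭`, Mathlib `IsAffineOpen.isLocalization_stalk'`). [cite: Hartshorne1977, II Prop. 2.2 (b) (p. 71)] -/
theorem isRegularLocalRing_localization_of_isRegular {V : X.Opens} (hV : IsAffineOpen V)
    (hreg : ∀ x : X, x ∈ V → IsRegularLocalRing (X.presheaf.stalk x)) (p : PrimeSpectrum Γ(X, V)) :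
    IsRegularLocalRing (Localization.AtPrime p.asIdeal) := by
  have hx : hV.fromSpec p ∈ V := (hV.isoSpec.inv p).2
  letI : Algebra Γ(X, V) (X.presheaf.stalk (hV.fromSpec p)) :=
    TopCat.Presheaf.algebra_section_stalk X.presheaf ⟨hV.fromSpec p, hx⟩
  have hloc : IsLocalization.AtPrime (X.presheaf.stalk (hV.fromSpec p)) p.asIdeal :=
    hV.isLocalization_stalk' p hx
  let e : Localization.AtPrime p.asIdeal ≃+* X.presheaf.stalk (hV.fromSpec p) :=
    (IsLocalization.algEquiv p.asIdeal.primeCompl (Localization.AtPrime p.asIdeal)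
      (X.presheaf.stalk (hV.fromSpec p))).toRingEquiv
  haveI := hreg _ hx
  exact IsRegularLocalRing.of_ringEquiv e.symm

/-- On an affine open `V` of a locally noetherian scheme with regular stalks on `V`, the sections of a
coherent `F` have FINITE projective dimension over `Γ(V, 𝒪_X)` (Görtz–Wedhorn II, Prop. G.5, via
`exists_hasProjectiveDimensionLE_of_isRegularLocalRing_localization`). [cite: GortzWedhorn2023, Prop. G.5] -/
theorem exists_hasProjectiveDimensionLE_sections_of_isRegular [IsLocallyNoetherian X] {V : X.Opens}
    (hV : IsAffineOpen V) (hreg : ∀ x : X, x ∈ V → IsRegularLocalRing (X.presheaf.stalk x))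
    {F : X.Modules} (hF : Coh F) :
    ∃ d : ℕ, HasProjectiveDimensionLE (ModuleCat.of Γ(X, V) Γ(F, V)) d := by
  haveI : IsNoetherianRing Γ(X, V) := IsLocallyNoetherian.component_noetherian ⟨V, hV⟩
  haveI : Module.Finite Γ(X, V) Γ(F, V) := hF.ft hV
  exact exists_hasProjectiveDimensionLE_of_isRegularLocalRing_localization
    (isRegularLocalRing_localization_of_isRegular hV hreg) _

/-- **On a noetherian regular scheme, one bound `d` with `pd_{Γ(V)} Γ(V, F) ≤ d` on an affine neighbourhood
`V` of every point**, for `F` coherent: take a finite affine cover and the maximum of the (finite) projective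
dimensions of the sections of `F` on its members. [cite: GortzWedhorn2023, Prop. 23.55 and Prop. G.5] -/
theorem exists_forall_hasProjectiveDimensionLE_sections [IsNoetherian X] (hreg : Scheme.IsRegular X)
    {F : X.Modules} (hF : Coh F) :
    ∃ d : ℕ, ∀ x : X, ∃ (V : X.Opens) (_ : IsAffineOpen V), x ∈ V ∧
      HasProjectiveDimensionLE (ModuleCat.of Γ(X, V) Γ(F, V)) d := by
  classical
  obtain ⟨t, ht⟩ := exists_finite_affineOpens_iSup_eq_top (X := X)
  have hpd : ∀ a : t, ∃ d : ℕ,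
      HasProjectiveDimensionLE (ModuleCat.of Γ(X, (a : X.affineOpens)) Γ(F, (a : X.affineOpens))) d :=
    fun a => exists_hasProjectiveDimensionLE_sections_of_isRegular (a : X.affineOpens).2
      (fun x _ => hreg x) hF
  choose n hn using hpd
  refine ⟨Finset.univ.sup n, fun x => ?_⟩
  have hx : x ∈ (⨆ a : t, ((a : X.affineOpens) : X.Opens)) := by rw [ht]; trivial
  obtain ⟨a, ha⟩ := Opens.mem_iSup.mp hx
  refine ⟨(a : X.affineOpens), (a : X.affineOpens).2, ha, ?_⟩
  haveI := hn a
  exact hasProjectiveDimensionLT_of_ge _ (n a + 1) (Finset.univ.sup n + 1)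
    (by have := Finset.le_sup (f := n) (Finset.mem_univ a); omega)

/-! ### §3 The frontier kernel on a noetherian regular scheme -/

/-- **Syzygy sheaves on a noetherian regular scheme are eventually finite locally free, with no dimension
hypothesis** (Hartshorne III Ex. 6.9 (a); Görtz–Wedhorn II, Prop. 23.55): for `F` coherent on a noetherian
scheme all of whose stalks are regular local rings there is `d : ℕ` such that, for every complex `Q` of finite
locally free modules with `Q¹ = 0` and every `β : Q ⟶ F[0]` which is a quasi-isomorphism in all degrees `> f`,
`f < 0`, `f + d ≤ 1`, the kernel `ker(Qᶠ → Qᶠ⁺¹)` is finite locally free.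
[cite: Hartshorne1977, III Ex. 6.9 (a) (p. 238)] [cite: GortzWedhorn2023, Prop. 23.55] -/
theorem exists_isFiniteLocallyFree_kernel_of_isRegular [IsNoetherian X] (hreg : Scheme.IsRegular X)
    {F : X.Modules} (hF : Coh F) :
    ∃ d : ℕ, ∀ (Q : CochainComplex X.Modules ℤ), (∀ i, IsFiniteLocallyFree (Q.X i)) → IsZero (Q.X 1) →
      ∀ (β : Q ⟶ (single X.Modules (ComplexShape.up ℤ) 0).obj F) (f : ℤ), (∀ i, f < i → QuasiIsoAt β i) →
        f < 0 → f + d ≤ 1 → IsFiniteLocallyFree (kernel (Q.d f (f + 1))) := by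
  obtain ⟨d, hd⟩ := exists_forall_hasProjectiveDimensionLE_sections hreg hF
  exact ⟨d, fun Q hQ h1 β f hβ hf0 hfd => isFiniteLocallyFree_kernel_of_forall_pd hF hd Q hQ h1 β hβ hf0 hfd⟩

end Regular

end Literature.AlgebraicGeometry.Modules

end
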